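import Summits.QuantumFields.BalabanUV.Beta.FP.PackedLegBlocks
import Summits.QuantumFields.BalabanUV.Beta.FP.RelInvPeriodisedChartMinOpRecord
import Summits.QuantumFields.BalabanUV.Beta.FP.RelInvPeriodisedChartEffForm
import Summits.QuantumFields.BalabanUV.Beta.FP.RelInvPeriodisedSliced

/-!
# `BalabanUV.Beta.FP.PackedLegCombRooted` — road «FP» for binder row D1, ROUTE T, SPEC #41 «THE `j ≥ 2` ASSEMBLY» (S3-1)-G: **THE ROOTED COMB LEG IN
# DISPLAYED WORDS** — the twin of leaf-05's `PackedLegBlocksAtSlices.packedLeg_comb_eq ∕ kkt_mul_inv_comb` (root `ctr`, kernel `bhKStepSh·Dsh` — the (III′)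
# record) for the comb slice of the TOWER's top step as #21 `NestedStepLawTorusCompositeOneShotTop` types it: ROOTED at an in-block root `r` (`τ₂ := combF
# Lc M′ (rs 0) = (combRowsT (toSite r) Lc M).submatrix id (fields)`), form `(perF M 𝕄)|ff`, averaging rows `(perF M 𝕄).submatrix fμ (fields)` for ANY
# lattice chart `(A, 𝕄)` with the seven letters (chart-generic: leaf-05's `RelInvPeriodisedChart*` lineage BY NAME), and the CANONICAL instance
# `(A, 𝕄) := (Π̂ᵀ(KInvStep Lc j)Π̂ rooted at r, bhKStepAt d (toSite r) Lc j)` whose seven letters are an2's ∕ leaf-05's theorems BY NAME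

WHY.  The `G` system of #21 is `kkt S₁₁ [Q₂₀; τ₂]` with `S₁₁ = (∏ (wVH d Lc (lev i))⁻¹) • (perF M′ (bhKStepAt d (toSite (rs 0)) Lc (lev 0)))|ff`
(leaf-05 `TorusEffFormComposite.torus_composite_inv_and_eff` .2), `Q₂₀ = (perF M′ (bhKStepAt d (toSite (rs 0)) Lc (lev 0))).submatrix (pμ′, inr mμ′) (fields)`,
`τ₂ = combF Lc M′ (rs 0)`: ROOTED at `rs 0`, kernel `bhKStepAt` — leaf-05's `packedLeg_comb_eq` is the root-`ctr` ∕ `bhKStepSh` instance and does not apply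
verbatim.  The chart-generic rooted block letters all exist (leaf-05 g29∕g30: `RelInvPeriodisedChartMinOpRecord.torus_flucCov_eq_of_relInv ∕
torus_minOp_submatrix_inl_of_relInv ∕ torus_minOpL_submatrix_inl_of_relInv`, `RelInvPeriodisedChartEffForm.effForm_toBlocks₁₁_of_relInv`,
`RelInvPeriodisedChartCombRows.torus_isUnit_det_kkt_combRows_of_relInv`); THIS FILE assembles them into the LEG (#27 `packedLeg_kktInv`) and the right-inverse
socket, and instantiates at the canonical rooted chart (`RelInvPeriodised.perF_rules_wall`'s objects: an2 `relInv_coDressKBmAt_KInvStep_bhKStepAt`,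
`spr_bhKStepAt`, `decays_coDressKBmAt_KInvStep`, `shiftK_coDressKBmAt_KInvStep`, `shiftK_bhKStepAt`, `bhKStepAt_inr_inr`, `bhKStepAt_inl_inr_eq_neg`).
* §1 chart-generic, rooted: **`packedLeg_combAt_eq_of_relInv`** (`((kkt (M̂|ff) [M̂.sub fμ ff; combF])⁻¹).submatrix e e = fromBlocks Γ I L (−S)` over `perF M A`,
  live indicator `axEc (toSite r) Lc`), **`kkt_mul_inv_combAt_of_relInv`** (`kkt … * (kkt …)⁻¹ = 1`);
* §2 the canonical rooted chart's seven letters packaged (`canonical_letters_combAt`) and the two instances **`packedLeg_combAt_eq`**, **`kkt_mul_inv_combAt`**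
  over `perF M (coDressKBmAt (toSite r) Lc (KInvStep Lc j))`, plus the torus rules `perF_rules_combAt` (`Ê·Â = Â = Â·Ê`, `perF_rules_wall` .1∕.2.1).
[folklore] one-line assemblies of landed letters; no `def`, no `def … : Prop`, nothing cited, 0 sorry; 0 estimates.  NOT HERE: the unit `∏ (wVH)⁻¹` of the
composite's effective form (moved onto the blocks by #40a `KktUnitConjugation` in `TowerLawFullIndex`), the one-shot legs (leaf-05 `packedLeg_oneShot_eq`).

HONEST DEPENDENCY (page 1, mandatory): continuum YM on T⁴ ⇐ BetaPertH ∧ nine spine estimates (0/9 proved); BetaPertH ⇐ (D1) ∧ (D4) ∧ CAP+tail;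
G-an2-4 gates asym, D1 and NE2/3/4.  HONEST FRAMING (cell contract, verbatim): «discharging `BetaPertH` makes Bałaban's UV stability UNCONDITIONAL —
a real constructive-QFT result; it is NOT the continuum limit and NOT the Clay problem.»  ABSOLUTE RULE (cell charter, verbatim): «No internally-minted
statement may enter as a cited fact. Every hypothesis is either kernel-proved in this package or a verbatim quotation of a PUBLISHED theorem with page
reference. The manuscript(s) under audit are NOT citable for their own disputed steps — they are the thing under adjudication; programme-internal
(2001/route/tribunal) claims are never citable.»  0∕4 row-D1 binders (hW, hR, D1Tel, D1Rep); NOT (T-ID), NOT SDF, NOT D1, NOT BetaPertH, NOT continuum,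
NOT Clay.  Road «FP» OWNER, b2b-balaban-beta-d1-p3 gen 27, 2026-08-23.  No existing file touched.
-/

noncomputable section

open scoped BigOperators Matrix

namespace Summit.QuantumFields.BalabanUV.Beta.FP.PackedLegCombRooted

open Matrix
open Literature.Probability.LatticeModels (Torus.proj)
open Literature.MathematicalPhysics.QuantumFieldTheory.Balaban1983to89
open Literature.MathematicalPhysics.QuantumFieldTheory.Balaban1983to89.Beta
open Literature.MathematicalPhysics.QuantumFieldTheory.Balaban1983to89.Beta.Composition (kkt)
open Literature.MathematicalPhysics.QuantumFieldTheory.Balaban1983to89.Beta.CompositionSingular (effForm flucCov minOp minOpL)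
open B6Lemma24Torus (pbox)
open ExpKernelCalculus (MKer shiftK)
open AffineAveraging (Site box toSite)
open OneStepResolventKernel (Fib)
open OneStepKernelFamily (KInvStep)
open Summit.QuantumFields.BalabanUV.Beta.TameKernelCalculus (Spr)
open Summit.QuantumFields.BalabanUV.Beta.ChartConjugationRelative (RelInv)
open Summit.QuantumFields.BalabanUV.Beta.AxialDressingRooted (coDressKBmAt axEc decays_coDressKBmAt_KInvStep shiftK_coDressKBmAt_KInvStep)
open Summit.QuantumFields.BalabanUV.Beta.BorderedHessian (bhKStepAt spr_bhKStepAt relInv_coDressKBmAt_KInvStep_bhKStepAt)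
open Summit.QuantumFields.BalabanUV.Beta.FP.KernelPeriodisationFib (Idx perF)
open Summit.QuantumFields.BalabanUV.Beta.FP.TorusCombRows (Res combRowsT)
open Summit.QuantumFields.BalabanUV.Beta.FP.PackedLegBlocks (packedLeg_kktInv)
open Summit.QuantumFields.BalabanUV.Beta.FP.RelInvPeriodised (shiftK_bhKStepAt perF_rules_wall)
open Summit.QuantumFields.BalabanUV.Beta.FP.RelInvPeriodisedSliced (bhKStepAt_inr_inr bhKStepAt_inl_inr_eq_neg)
open Summit.QuantumFields.BalabanUV.Beta.FP.RelInvPeriodisedChartMinOpRecord (torus_flucCov_eq_of_relInv torus_minOp_submatrix_inl_of_relInv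
  torus_minOpL_submatrix_inl_of_relInv)
open Summit.QuantumFields.BalabanUV.Beta.FP.RelInvPeriodisedChartEffForm (effForm_toBlocks₁₁_of_relInv)
open Summit.QuantumFields.BalabanUV.Beta.FP.RelInvPeriodisedChartCombRows (torus_isUnit_det_kkt_combRows_of_relInv)

/-! ## §1 Chart-generic, rooted: the comb leg in the four named blocks and its right-inverse socket -/

section Chart

variable {d : ℕ} {Lc : ℕ} [NeZero Lc] {r : Fin (d + 1) → ℕ} (M : Fin (d + 1) → ℕ) [∀ μ, NeZero (M μ)] {A Mh : MKer (d + 1) (Fib d)}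

set_option synthInstance.maxSize 1024 in
/-- [folklore] **THE ROOTED COMB LEG IN DISPLAYED WORDS, ANY CHART**: for a lattice chart `(A, 𝕄)` with the seven letters at scale `Lc` and root `toSite r`
(`r ∈ box (d+1) Lc`), any injective `inr`-valued coarse presentation `fμ` with `hcoarse`, and the comb rows `combRowsT (toSite r) Lc M` on the field slots:
`((kkt (M̂|ff) [M̂.submatrix fμ (fields); comb rows])⁻¹).submatrix (Sum.map id inl) (Sum.map id inl) = fromBlocks Γ I L (−S)` with
`Γ = of (axEc·axEc·perF M A)`, `I = of (axEc·perF M A (·, fμ ·))`, `L = −of (axEc·perF M A (fμ ·, ·))`, `S = (perF M A).submatrix fμ fμ` — #27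
`packedLeg_kktInv`, then leaf-05's four rooted chart block letters left to right. -/
theorem packedLeg_combAt_eq_of_relInv (hr : r ∈ box (d + 1) Lc) (hM : ∀ i, Lc ∣ M i) (hA : Spr A) (hMh : Spr Mh)
    (hAt : ∀ t : Fin (d + 1) → ℤ, shiftK ((Lc : ℤ) • t) A = A) (hMt : ∀ t : Fin (d + 1) → ℤ, shiftK ((Lc : ℤ) • t) Mh = Mh)
    (hrel : RelInv A Mh (axEc (toSite r) Lc))
    (hmm : ∀ (x y : Fin (d + 1) → ℤ) (κ l : Fin (d + 1)), Mh x y (Sum.inr κ) (Sum.inr l) = 0)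
    (hanti : ∀ (x y : Fin (d + 1) → ℤ) (κ l : Fin (d + 1)), Mh x y (Sum.inl κ) (Sum.inr l) = -Mh y x (Sum.inr l) (Sum.inl κ))
    {μ : Type*} [Fintype μ] [DecidableEq μ] (fμ : μ → Idx M (Fib d)) (hfμ : Function.Injective fμ)
    (hμ : ∀ a : μ, ∃ m : Fin (d + 1), (fμ a).2 = Sum.inr m)
    (hcoarse : ∀ (s : ↥(pbox M)) (m : Fin (d + 1)), ((s, Sum.inr m) : Idx M (Fib d)) ∈ Set.range fμ ↔ Torus.proj Lc (s : Site (d + 1)) = 0) :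
    ((kkt ((perF M Mh).submatrix (fun b : ↥(pbox M) × Fin (d + 1) => ((b.1, Sum.inl b.2) : Idx M (Fib d)))
          (fun b : ↥(pbox M) × Fin (d + 1) => ((b.1, Sum.inl b.2) : Idx M (Fib d))))
        (fromRows ((perF M Mh).submatrix fμ (fun b : ↥(pbox M) × Fin (d + 1) => ((b.1, Sum.inl b.2) : Idx M (Fib d))))
          ((combRowsT (toSite r) Lc M).submatrix id (fun b : ↥(pbox M) × Fin (d + 1) => ((b.1, Sum.inl b.2) : Idx M (Fib d))))))⁻¹).submatrix
        (Sum.map id Sum.inl) (Sum.map id Sum.inl)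
      = fromBlocks
          (Matrix.of fun (b b' : ↥(pbox M) × Fin (d + 1)) =>
          axEc (toSite r) Lc (b.1 : Site (d + 1)) (b.1 : Site (d + 1)) (Sum.inl b.2) (Sum.inl b.2)
            * (axEc (toSite r) Lc (b'.1 : Site (d + 1)) (b'.1 : Site (d + 1)) (Sum.inl b'.2) (Sum.inl b'.2)
              * perF M A (b.1, Sum.inl b.2) (b'.1, Sum.inl b'.2)))
          (Matrix.of fun (b : ↥(pbox M) × Fin (d + 1)) (a : μ) =>
          axEc (toSite r) Lc (b.1 : Site (d + 1)) (b.1 : Site (d + 1)) (Sum.inl b.2) (Sum.inl b.2) * perF M A (b.1, Sum.inl b.2) (fμ a))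
          (-Matrix.of fun (a : μ) (b : ↥(pbox M) × Fin (d + 1)) =>
          axEc (toSite r) Lc (b.1 : Site (d + 1)) (b.1 : Site (d + 1)) (Sum.inl b.2) (Sum.inl b.2) * perF M A (fμ a) (b.1, Sum.inl b.2))
          (-((perF M A).submatrix fμ fμ)) := by
  rw [packedLeg_kktInv,
    torus_flucCov_eq_of_relInv M hr hM hA hMh hAt hMt hrel hmm hanti fμ hfμ hμ hcoarse,
    torus_minOp_submatrix_inl_of_relInv M hr hM hA hMh hAt hMt hrel hmm hanti fμ hfμ hμ hcoarse,
    torus_minOpL_submatrix_inl_of_relInv M hr hM hA hMh hAt hMt hrel hmm hanti fμ hfμ hμ hcoarse,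
    effForm_toBlocks₁₁_of_relInv M hr hM hA hMh hAt hMt hrel hmm hanti fμ hfμ hμ hcoarse]

set_option synthInstance.maxSize 1024 in
/-- [folklore] **#24's RIGHT-INVERSE SOCKET AT THE ROOTED COMB LEG, ANY CHART**, `X := (kkt (M̂|ff) [M̂.submatrix fμ (fields); comb rows])⁻¹`:
`kkt … * X = 1` (`Matrix.mul_nonsing_inv` + leaf-05 `torus_isUnit_det_kkt_combRows_of_relInv`). -/
theorem kkt_mul_inv_combAt_of_relInv (hr : r ∈ box (d + 1) Lc) (hM : ∀ i, Lc ∣ M i) (hA : Spr A) (hMh : Spr Mh)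
    (hAt : ∀ t : Fin (d + 1) → ℤ, shiftK ((Lc : ℤ) • t) A = A) (hMt : ∀ t : Fin (d + 1) → ℤ, shiftK ((Lc : ℤ) • t) Mh = Mh)
    (hrel : RelInv A Mh (axEc (toSite r) Lc))
    (hmm : ∀ (x y : Fin (d + 1) → ℤ) (κ l : Fin (d + 1)), Mh x y (Sum.inr κ) (Sum.inr l) = 0)
    (hanti : ∀ (x y : Fin (d + 1) → ℤ) (κ l : Fin (d + 1)), Mh x y (Sum.inl κ) (Sum.inr l) = -Mh y x (Sum.inr l) (Sum.inl κ))
    {μ : Type*} [Fintype μ] [DecidableEq μ] (fμ : μ → Idx M (Fib d)) (hfμ : Function.Injective fμ)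
    (hμ : ∀ a : μ, ∃ m : Fin (d + 1), (fμ a).2 = Sum.inr m)
    (hcoarse : ∀ (s : ↥(pbox M)) (m : Fin (d + 1)), ((s, Sum.inr m) : Idx M (Fib d)) ∈ Set.range fμ ↔ Torus.proj Lc (s : Site (d + 1)) = 0) :
    kkt ((perF M Mh).submatrix (fun b : ↥(pbox M) × Fin (d + 1) => ((b.1, Sum.inl b.2) : Idx M (Fib d)))
          (fun b : ↥(pbox M) × Fin (d + 1) => ((b.1, Sum.inl b.2) : Idx M (Fib d))))
        (fromRows ((perF M Mh).submatrix fμ (fun b : ↥(pbox M) × Fin (d + 1) => ((b.1, Sum.inl b.2) : Idx M (Fib d))))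
          ((combRowsT (toSite r) Lc M).submatrix id (fun b : ↥(pbox M) × Fin (d + 1) => ((b.1, Sum.inl b.2) : Idx M (Fib d)))))
      * (kkt ((perF M Mh).submatrix (fun b : ↥(pbox M) × Fin (d + 1) => ((b.1, Sum.inl b.2) : Idx M (Fib d)))
          (fun b : ↥(pbox M) × Fin (d + 1) => ((b.1, Sum.inl b.2) : Idx M (Fib d))))
        (fromRows ((perF M Mh).submatrix fμ (fun b : ↥(pbox M) × Fin (d + 1) => ((b.1, Sum.inl b.2) : Idx M (Fib d))))
          ((combRowsT (toSite r) Lc M).submatrix id (fun b : ↥(pbox M) × Fin (d + 1) => ((b.1, Sum.inl b.2) : Idx M (Fib d))))))⁻¹ = 1 :=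
  Matrix.mul_nonsing_inv _ (torus_isUnit_det_kkt_combRows_of_relInv M hr hM hA hMh hAt hMt hrel hmm hanti fμ hfμ hμ hcoarse)

end Chart

/-! ## §2 The canonical rooted chart `(Π̂ᵀ(KInvStep Lc j)Π̂, bhKStepAt d (toSite r) Lc j)`: the seven letters by name, the leg, the right inverse, the rules -/

section Canonical

variable {d : ℕ} {Lc : ℕ} [NeZero Lc] {r : Fin (d + 1) → ℕ} (M : Fin (d + 1) → ℕ) [∀ μ, NeZero (M μ)]

/-- [folklore] **THE SEVEN CHART LETTERS OF THE CANONICAL ROOTED CHART**, packaged (an2 `decays_coDressKBmAt_KInvStep` ∕ `spr_bhKStepAt` ∕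
`shiftK_coDressKBmAt_KInvStep` ∕ `relInv_coDressKBmAt_KInvStep_bhKStepAt`, leaf-05 `shiftK_bhKStepAt` ∕ `bhKStepAt_inr_inr` ∕ `bhKStepAt_inl_inr_eq_neg`). -/
theorem canonical_letters_combAt (hr : r ∈ box (d + 1) Lc) (j : ℕ) :
    Spr (coDressKBmAt (toSite r) Lc (KInvStep (d := d) Lc j)) ∧ Spr (bhKStepAt d (toSite r) Lc j)
      ∧ (∀ t : Fin (d + 1) → ℤ, shiftK ((Lc : ℤ) • t) (coDressKBmAt (toSite r) Lc (KInvStep (d := d) Lc j)) = coDressKBmAt (toSite r) Lc (KInvStep (d := d) Lc j))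
      ∧ (∀ t : Fin (d + 1) → ℤ, shiftK ((Lc : ℤ) • t) (bhKStepAt d (toSite r) Lc j) = bhKStepAt d (toSite r) Lc j)
      ∧ RelInv (coDressKBmAt (toSite r) Lc (KInvStep (d := d) Lc j)) (bhKStepAt d (toSite r) Lc j) (axEc (toSite r) Lc)
      ∧ (∀ (x y : Fin (d + 1) → ℤ) (κ l : Fin (d + 1)), bhKStepAt d (toSite r) Lc j x y (Sum.inr κ) (Sum.inr l) = 0)
      ∧ (∀ (x y : Fin (d + 1) → ℤ) (κ l : Fin (d + 1)),
          bhKStepAt d (toSite r) Lc j x y (Sum.inl κ) (Sum.inr l) = -bhKStepAt d (toSite r) Lc j y x (Sum.inr l) (Sum.inl κ)) := by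
  obtain ⟨δ, C, hδ, -, hA⟩ := decays_coDressKBmAt_KInvStep (d := d) (Lc := Lc) hr j
  refine ⟨⟨C, δ, hδ, hA⟩, spr_bhKStepAt hr j, fun t => ?_, fun t => shiftK_bhKStepAt (toSite r) Lc t j, relInv_coDressKBmAt_KInvStep_bhKStepAt hr j,
    fun x y κ l => bhKStepAt_inr_inr (toSite r) Lc j x y κ l, fun x y κ l => bhKStepAt_inl_inr_eq_neg (toSite r) Lc j x y κ l⟩
  have h := shiftK_coDressKBmAt_KInvStep (d := d) (Lc := Lc) (toSite r) j (-t)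
  rwa [smul_neg, neg_neg] at h

set_option synthInstance.maxSize 1024 in
/-- [folklore] **THE ROOTED COMB LEG IN DISPLAYED WORDS AT THE CANONICAL CHART** (#21's `G` system after the unit is moved onto the blocks):
`((kkt (𝓗|ff) [𝓗.submatrix fμ (fields); comb rows])⁻¹).submatrix e e = fromBlocks Γ I L (−S)` over `Â := perF M (coDressKBmAt (toSite r) Lc (KInvStep Lc j))`,
`𝓗 := perF M (bhKStepAt d (toSite r) Lc j)`. -/
theorem packedLeg_combAt_eq (hr : r ∈ box (d + 1) Lc) (hM : ∀ i, Lc ∣ M i) (j : ℕ)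
    {μ : Type*} [Fintype μ] [DecidableEq μ] (fμ : μ → Idx M (Fib d)) (hfμ : Function.Injective fμ)
    (hμ : ∀ a : μ, ∃ m : Fin (d + 1), (fμ a).2 = Sum.inr m)
    (hcoarse : ∀ (s : ↥(pbox M)) (m : Fin (d + 1)), ((s, Sum.inr m) : Idx M (Fib d)) ∈ Set.range fμ ↔ Torus.proj Lc (s : Site (d + 1)) = 0) :
    ((kkt ((perF M (bhKStepAt d (toSite r) Lc j)).submatrix (fun b : ↥(pbox M) × Fin (d + 1) => ((b.1, Sum.inl b.2) : Idx M (Fib d)))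
          (fun b : ↥(pbox M) × Fin (d + 1) => ((b.1, Sum.inl b.2) : Idx M (Fib d))))
        (fromRows ((perF M (bhKStepAt d (toSite r) Lc j)).submatrix fμ (fun b : ↥(pbox M) × Fin (d + 1) => ((b.1, Sum.inl b.2) : Idx M (Fib d))))
          ((combRowsT (toSite r) Lc M).submatrix id (fun b : ↥(pbox M) × Fin (d + 1) => ((b.1, Sum.inl b.2) : Idx M (Fib d))))))⁻¹).submatrix
        (Sum.map id Sum.inl) (Sum.map id Sum.inl)
      = fromBlocks
          (Matrix.of fun (b b' : ↥(pbox M) × Fin (d + 1)) =>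
          axEc (toSite r) Lc (b.1 : Site (d + 1)) (b.1 : Site (d + 1)) (Sum.inl b.2) (Sum.inl b.2)
            * (axEc (toSite r) Lc (b'.1 : Site (d + 1)) (b'.1 : Site (d + 1)) (Sum.inl b'.2) (Sum.inl b'.2)
              * perF M (coDressKBmAt (toSite r) Lc (KInvStep (d := d) Lc j)) (b.1, Sum.inl b.2) (b'.1, Sum.inl b'.2)))
          (Matrix.of fun (b : ↥(pbox M) × Fin (d + 1)) (a : μ) =>
          axEc (toSite r) Lc (b.1 : Site (d + 1)) (b.1 : Site (d + 1)) (Sum.inl b.2) (Sum.inl b.2)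
            * perF M (coDressKBmAt (toSite r) Lc (KInvStep (d := d) Lc j)) (b.1, Sum.inl b.2) (fμ a))
          (-Matrix.of fun (a : μ) (b : ↥(pbox M) × Fin (d + 1)) =>
          axEc (toSite r) Lc (b.1 : Site (d + 1)) (b.1 : Site (d + 1)) (Sum.inl b.2) (Sum.inl b.2)
            * perF M (coDressKBmAt (toSite r) Lc (KInvStep (d := d) Lc j)) (fμ a) (b.1, Sum.inl b.2))
          (-((perF M (coDressKBmAt (toSite r) Lc (KInvStep (d := d) Lc j))).submatrix fμ fμ)) := by
  obtain ⟨hA, hMh, hAt, hMt, hrel, hmm, hanti⟩ := canonical_letters_combAt (d := d) (Lc := Lc) hr j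
  exact packedLeg_combAt_eq_of_relInv M hr hM hA hMh hAt hMt hrel hmm hanti fμ hfμ hμ hcoarse

set_option synthInstance.maxSize 1024 in
/-- [folklore] **THE RIGHT INVERSE AT THE CANONICAL ROOTED COMB**: `kkt (𝓗|ff) [𝓗.submatrix fμ (fields); comb rows] * (…)⁻¹ = 1`. -/
theorem kkt_mul_inv_combAt (hr : r ∈ box (d + 1) Lc) (hM : ∀ i, Lc ∣ M i) (j : ℕ)
    {μ : Type*} [Fintype μ] [DecidableEq μ] (fμ : μ → Idx M (Fib d)) (hfμ : Function.Injective fμ)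
    (hμ : ∀ a : μ, ∃ m : Fin (d + 1), (fμ a).2 = Sum.inr m)
    (hcoarse : ∀ (s : ↥(pbox M)) (m : Fin (d + 1)), ((s, Sum.inr m) : Idx M (Fib d)) ∈ Set.range fμ ↔ Torus.proj Lc (s : Site (d + 1)) = 0) :
    kkt ((perF M (bhKStepAt d (toSite r) Lc j)).submatrix (fun b : ↥(pbox M) × Fin (d + 1) => ((b.1, Sum.inl b.2) : Idx M (Fib d)))
          (fun b : ↥(pbox M) × Fin (d + 1) => ((b.1, Sum.inl b.2) : Idx M (Fib d))))
        (fromRows ((perF M (bhKStepAt d (toSite r) Lc j)).submatrix fμ (fun b : ↥(pbox M) × Fin (d + 1) => ((b.1, Sum.inl b.2) : Idx M (Fib d))))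
          ((combRowsT (toSite r) Lc M).submatrix id (fun b : ↥(pbox M) × Fin (d + 1) => ((b.1, Sum.inl b.2) : Idx M (Fib d)))))
      * (kkt ((perF M (bhKStepAt d (toSite r) Lc j)).submatrix (fun b : ↥(pbox M) × Fin (d + 1) => ((b.1, Sum.inl b.2) : Idx M (Fib d)))
          (fun b : ↥(pbox M) × Fin (d + 1) => ((b.1, Sum.inl b.2) : Idx M (Fib d))))
        (fromRows ((perF M (bhKStepAt d (toSite r) Lc j)).submatrix fμ (fun b : ↥(pbox M) × Fin (d + 1) => ((b.1, Sum.inl b.2) : Idx M (Fib d))))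
          ((combRowsT (toSite r) Lc M).submatrix id (fun b : ↥(pbox M) × Fin (d + 1) => ((b.1, Sum.inl b.2) : Idx M (Fib d))))))⁻¹ = 1 := by
  obtain ⟨hA, hMh, hAt, hMt, hrel, hmm, hanti⟩ := canonical_letters_combAt (d := d) (Lc := Lc) hr j
  exact kkt_mul_inv_combAt_of_relInv M hr hM hA hMh hAt hMt hrel hmm hanti fμ hfμ hμ hcoarse

/-- [folklore] **THE TORUS RULES OF THE CANONICAL ROOTED CHART** (`Ê·Â = Â`, `Â·Ê = Â` — `RelInvPeriodised.perF_rules_wall` .1 ∕ .2.1; #39's `hEA hAE`). -/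
theorem perF_rules_combAt (hr : r ∈ box (d + 1) Lc) (hM : ∀ i, Lc ∣ M i) (j : ℕ) :
    perF M (axEc (toSite r) Lc) * perF M (coDressKBmAt (toSite r) Lc (KInvStep (d := d) Lc j)) = perF M (coDressKBmAt (toSite r) Lc (KInvStep (d := d) Lc j))
      ∧ perF M (coDressKBmAt (toSite r) Lc (KInvStep (d := d) Lc j)) * perF M (axEc (toSite r) Lc)
        = perF M (coDressKBmAt (toSite r) Lc (KInvStep (d := d) Lc j)) :=
  ⟨(perF_rules_wall M hr hM j).1, (perF_rules_wall M hr hM j).2.1⟩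

end Canonical

/-! ## §3 (road g61, 2026-08-29; v11-R ∕ FINDING FP-66) The centred instance IN THE DOOR's BINDER SHAPES: the rooted twin of leaf-05's `PackedLegCombSym`

Under the row's (R-root) ruling (an2 W-8 R-1) the END's top-step slot rows are `Q₂₀ = (perF M′ (bhKStepAt d (toSite (ctrOff (d+1) Lc)) Lc ℓ)).submatrix (slots) (fields)`;
the G system `kkt 𝓗|ff [Q₂₀; τ₂]` of the per-storey tower law (`TowerLawFullIndexGB.hessT_fullIndex_law_tower_G`'s `hXG hLG hEAG hAEG` + the (P2‴) letters `hAG hAGsh`)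
is then THIS file's §2 at `r := ctrOff (d+1) Lc` — NOT leaf-05's sym comb leg over the (III′) comb chart (`PackedLegCombSym`, which `TowerKernelLawNamedC` L.311 uses).  The four
binder-shaped wrappers below (`hQ₂₀ hτ₂` displayed and `subst`ed, exactly as in `PackedLegCombSym`) feed `TowerKernelLawNamedRooted`; chart `A_G := coDressKBmAt (toSite (ctrOff (d+1) Lc))
Lc (KInvStep Lc ℓ)`, `ρ_G := ctr (d+1) Lc = toSite (ctrOff (d+1) Lc)` (`rfl`), `L_G := Lc`, `f_G a := (pμ′ a, inr (mμ′ a))`.  [folklore] one-line assemblies; no `def`, 0 sorry. -/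

section Door

open AveragingContoursRooted (ctrOff ctrOff_mem_box)

variable {d : ℕ} {Lc : ℕ} [NeZero Lc] (M' : Fin (d + 1) → ℕ) [∀ μ, NeZero (M' μ)]

set_option synthInstance.maxSize 1024 in
/-- [folklore] **`hXG` OF THE ROOTED TOWER LAW AT `X_G := (kkt 𝓗|ff [Q₂₀; τ₂])⁻¹`** — the top ROOTED step's comb-KKT on the box `M′` (`Lc ∣ M′`), level `ℓ` (the door's
`lev 0`), averaging rows = W-8 R-1's `hQ₂₀′` in (B)'s slot presentation, comb slice `(combRowsT (toSite (ctrOff (d+1) Lc)) Lc M′).submatrix id (fields)` (= the door's `combF Lc M′ (ctrOff (d+1) Lc)`,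
`TorusCompositeObjects.combF`, by `rfl`): `kkt 𝓗|ff [Q₂₀; τ₂] * (kkt 𝓗|ff [Q₂₀; τ₂])⁻¹ = 1` (§2 `kkt_mul_inv_combAt` at `r := ctrOff (d+1) Lc`). -/
theorem kkt_mul_inv_combRooted (hM' : ∀ i, Lc ∣ M' i) (ℓ : ℕ)
    {κ : Type*} [Fintype κ] [DecidableEq κ] (pμ' : κ → ↥(pbox M')) (mμ' : κ → Fin (d + 1))
    (hfμ' : Function.Injective (fun a : κ => ((pμ' a, Sum.inr (mμ' a)) : Idx M' (Fib d))))
    (hcoarse' : ∀ (s : ↥(pbox M')) (m : Fin (d + 1)),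
      ((s, Sum.inr m) : Idx M' (Fib d)) ∈ Set.range (fun a : κ => ((pμ' a, Sum.inr (mμ' a)) : Idx M' (Fib d))) ↔ Torus.proj Lc (s : Site (d + 1)) = 0)
    {Q₂₀ : Matrix κ (↥(pbox M') × Fin (d + 1)) ℝ}
    (hQ₂₀ : Q₂₀ = (perF M' (bhKStepAt d (toSite (ctrOff (d + 1) Lc)) Lc ℓ)).submatrix (fun a : κ => ((pμ' a, Sum.inr (mμ' a)) : Idx M' (Fib d)))
        (fun b : ↥(pbox M') × Fin (d + 1) => ((b.1, Sum.inl b.2) : Idx M' (Fib d))))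
    {τ₂ : Matrix (Res (toSite (ctrOff (d + 1) Lc)) Lc M') (↥(pbox M') × Fin (d + 1)) ℝ} (hτ₂ : τ₂ = (combRowsT (toSite (ctrOff (d + 1) Lc)) Lc M').submatrix id (fun b : ↥(pbox M') × Fin (d + 1) => ((b.1, Sum.inl b.2) : Idx M' (Fib d)))) :
    kkt ((perF M' (bhKStepAt d (toSite (ctrOff (d + 1) Lc)) Lc ℓ)).submatrix (fun b : ↥(pbox M') × Fin (d + 1) => ((b.1, Sum.inl b.2) : Idx M' (Fib d)))
          (fun b : ↥(pbox M') × Fin (d + 1) => ((b.1, Sum.inl b.2) : Idx M' (Fib d)))) (fromRows Q₂₀ τ₂)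
      * (kkt ((perF M' (bhKStepAt d (toSite (ctrOff (d + 1) Lc)) Lc ℓ)).submatrix (fun b : ↥(pbox M') × Fin (d + 1) => ((b.1, Sum.inl b.2) : Idx M' (Fib d)))
          (fun b : ↥(pbox M') × Fin (d + 1) => ((b.1, Sum.inl b.2) : Idx M' (Fib d)))) (fromRows Q₂₀ τ₂))⁻¹ = 1 := by
  subst hQ₂₀ hτ₂
  exact kkt_mul_inv_combAt M' (ctrOff_mem_box (d := d + 1) (Nat.one_le_iff_ne_zero.mpr (NeZero.ne Lc))) hM' ℓ _ hfμ' (fun a => ⟨mμ' a, rfl⟩) hcoarse'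

set_option synthInstance.maxSize 1024 in
/-- [folklore] **`hLG` OF THE ROOTED TOWER LAW AT THE CANONICAL ROOTED CHART** `A_G := coDressKBmAt (toSite (ctrOff (d+1) Lc)) Lc (KInvStep Lc ℓ)`, `ρ_G := ctr (d+1) Lc`,
`L_G := Lc`, `f_G a := (pμ′ a, inr (mμ′ a))`, `X_G := (kkt 𝓗|ff [Q₂₀; τ₂])⁻¹`: `X_G.submatrix (Sum.map id inl) (Sum.map id inl) = fromBlocks Γ I L (−S)` read on the field diagonal
(§2 `packedLeg_combAt_eq` at `r := ctrOff (d+1) Lc`). -/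
theorem packedLeg_combRooted_eq (hM' : ∀ i, Lc ∣ M' i) (ℓ : ℕ)
    {κ : Type*} [Fintype κ] [DecidableEq κ] (pμ' : κ → ↥(pbox M')) (mμ' : κ → Fin (d + 1))
    (hfμ' : Function.Injective (fun a : κ => ((pμ' a, Sum.inr (mμ' a)) : Idx M' (Fib d))))
    (hcoarse' : ∀ (s : ↥(pbox M')) (m : Fin (d + 1)),
      ((s, Sum.inr m) : Idx M' (Fib d)) ∈ Set.range (fun a : κ => ((pμ' a, Sum.inr (mμ' a)) : Idx M' (Fib d))) ↔ Torus.proj Lc (s : Site (d + 1)) = 0)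
    {Q₂₀ : Matrix κ (↥(pbox M') × Fin (d + 1)) ℝ}
    (hQ₂₀ : Q₂₀ = (perF M' (bhKStepAt d (toSite (ctrOff (d + 1) Lc)) Lc ℓ)).submatrix (fun a : κ => ((pμ' a, Sum.inr (mμ' a)) : Idx M' (Fib d)))
        (fun b : ↥(pbox M') × Fin (d + 1) => ((b.1, Sum.inl b.2) : Idx M' (Fib d))))
    {τ₂ : Matrix (Res (toSite (ctrOff (d + 1) Lc)) Lc M') (↥(pbox M') × Fin (d + 1)) ℝ} (hτ₂ : τ₂ = (combRowsT (toSite (ctrOff (d + 1) Lc)) Lc M').submatrix id (fun b : ↥(pbox M') × Fin (d + 1) => ((b.1, Sum.inl b.2) : Idx M' (Fib d)))) :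
    ((kkt ((perF M' (bhKStepAt d (toSite (ctrOff (d + 1) Lc)) Lc ℓ)).submatrix (fun b : ↥(pbox M') × Fin (d + 1) => ((b.1, Sum.inl b.2) : Idx M' (Fib d)))
          (fun b : ↥(pbox M') × Fin (d + 1) => ((b.1, Sum.inl b.2) : Idx M' (Fib d)))) (fromRows Q₂₀ τ₂))⁻¹).submatrix (Sum.map id Sum.inl) (Sum.map id Sum.inl)
      = fromBlocks
          (Matrix.of fun (b b' : ↥(pbox M') × Fin (d + 1)) =>
            axEc (toSite (ctrOff (d + 1) Lc)) Lc (b.1 : Site (d + 1)) (b.1 : Site (d + 1)) (Sum.inl b.2) (Sum.inl b.2)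
              * (axEc (toSite (ctrOff (d + 1) Lc)) Lc (b'.1 : Site (d + 1)) (b'.1 : Site (d + 1)) (Sum.inl b'.2) (Sum.inl b'.2)
                * perF M' (coDressKBmAt (toSite (ctrOff (d + 1) Lc)) Lc (KInvStep (d := d) Lc ℓ)) (b.1, Sum.inl b.2) (b'.1, Sum.inl b'.2)))
          (Matrix.of fun (b : ↥(pbox M') × Fin (d + 1)) (a : κ) =>
            axEc (toSite (ctrOff (d + 1) Lc)) Lc (b.1 : Site (d + 1)) (b.1 : Site (d + 1)) (Sum.inl b.2) (Sum.inl b.2)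
              * perF M' (coDressKBmAt (toSite (ctrOff (d + 1) Lc)) Lc (KInvStep (d := d) Lc ℓ)) (b.1, Sum.inl b.2) ((pμ' a, Sum.inr (mμ' a)) : Idx M' (Fib d)))
          (-Matrix.of fun (a : κ) (b : ↥(pbox M') × Fin (d + 1)) =>
            axEc (toSite (ctrOff (d + 1) Lc)) Lc (b.1 : Site (d + 1)) (b.1 : Site (d + 1)) (Sum.inl b.2) (Sum.inl b.2)
              * perF M' (coDressKBmAt (toSite (ctrOff (d + 1) Lc)) Lc (KInvStep (d := d) Lc ℓ)) ((pμ' a, Sum.inr (mμ' a)) : Idx M' (Fib d)) (b.1, Sum.inl b.2))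
          (-((perF M' (coDressKBmAt (toSite (ctrOff (d + 1) Lc)) Lc (KInvStep (d := d) Lc ℓ))).submatrix (fun a : κ => ((pμ' a, Sum.inr (mμ' a)) : Idx M' (Fib d)))
              (fun a : κ => ((pμ' a, Sum.inr (mμ' a)) : Idx M' (Fib d))))) := by
  subst hQ₂₀ hτ₂
  exact packedLeg_combAt_eq M' (ctrOff_mem_box (d := d + 1) (Nat.one_le_iff_ne_zero.mpr (NeZero.ne Lc))) hM' ℓ _ hfμ' (fun a => ⟨mμ' a, rfl⟩) hcoarse'

/-- [folklore] **`hEAG ∧ hAEG`** at the canonical rooted chart rooted at `ctrOff (d+1) Lc`: `Ê·Â = Â` and `Â·Ê = Â` (§2 `perF_rules_combAt`). -/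
theorem perF_rules_combRooted (hM' : ∀ i, Lc ∣ M' i) (ℓ : ℕ) :
    perF M' (axEc (toSite (ctrOff (d + 1) Lc)) Lc) * perF M' (coDressKBmAt (toSite (ctrOff (d + 1) Lc)) Lc (KInvStep (d := d) Lc ℓ)) = perF M' (coDressKBmAt (toSite (ctrOff (d + 1) Lc)) Lc (KInvStep (d := d) Lc ℓ))
      ∧ perF M' (coDressKBmAt (toSite (ctrOff (d + 1) Lc)) Lc (KInvStep (d := d) Lc ℓ)) * perF M' (axEc (toSite (ctrOff (d + 1) Lc)) Lc) = perF M' (coDressKBmAt (toSite (ctrOff (d + 1) Lc)) Lc (KInvStep (d := d) Lc ℓ)) :=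
  perF_rules_combAt M' (ctrOff_mem_box (d := d + 1) (Nat.one_le_iff_ne_zero.mpr (NeZero.ne Lc))) hM' ℓ

end Door

section DoorLattice

open AveragingContoursRooted (ctrOff ctrOff_mem_box)

variable {d : ℕ} (Lc : ℕ) [NeZero Lc]

/-- [folklore] **`hAG hαG hAGsh` FOR `A_G := coDressKBmAt (toSite (ctrOff (d+1) Lc)) Lc (KInvStep Lc ℓ)`** (box-free): the canonical rooted chart decays (an2
`decays_coDressKBmAt_KInvStep`, ∃-packaged as `⟨C, α, 0 < α, Decays⟩`) and is blocking-`Lc` covariant (`canonical_letters_combAt` .2.2.1). -/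
theorem lattice_letters_combRooted (ℓ : ℕ) :
    (∃ C α : ℝ, 0 < α ∧ ExpKernelCalculus.Decays (coDressKBmAt (toSite (ctrOff (d + 1) Lc)) Lc (KInvStep (d := d) Lc ℓ)) C α)
      ∧ ∀ t : Fin (d + 1) → ℤ, shiftK ((Lc : ℤ) • t) (coDressKBmAt (toSite (ctrOff (d + 1) Lc)) Lc (KInvStep (d := d) Lc ℓ)) = coDressKBmAt (toSite (ctrOff (d + 1) Lc)) Lc (KInvStep (d := d) Lc ℓ) := by
  obtain ⟨δ, C, hδ, -, hA⟩ := decays_coDressKBmAt_KInvStep (d := d) (Lc := Lc) (ctrOff_mem_box (d := d + 1) (Nat.one_le_iff_ne_zero.mpr (NeZero.ne Lc))) ℓ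
  exact ⟨⟨C, δ, hδ, hA⟩, (canonical_letters_combAt (d := d) (Lc := Lc) (ctrOff_mem_box (d := d + 1) (Nat.one_le_iff_ne_zero.mpr (NeZero.ne Lc))) ℓ).2.2.1⟩

end DoorLattice

end Summit.QuantumFields.BalabanUV.Beta.FP.PackedLegCombRooted

end
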